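import Mathlib.Data.Nat.Bitwise
import Mathlib.Tactic
import HarnessLib

/-!
# The termination potential of the universal reduced run at `p = 2`: counting `κ`-free exponents
# (HIRONAKA-L, §9 kernel support; OURS combinatorics for the one-variable REDUCED MODEL `CampaignW24.ReducedRun` of slot W2.4 / the
# RD-2′ reduced slice, cell `res-hironaka`; companion of `MarkedTransferCampaignW24ReducedRunDeath.lean` (same author))

**HONEST FRAMING.** Pure arithmetic of natural numbers (bit-disjointness and a counting function); nothing below is a statement of
H. Hironaka's manuscript *Resolution of singularities in positive characteristics* [Hironaka2017] (lit key `paper:url-3343fd9e678b`),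
nothing asserts that any statement of it holds, nothing is a claim about resolution of singularities in characteristic `p`. OURS
bookkeeping for the reduced model (run/shared/lean/pub/res-hironaka/L/k24/PREREG-K24.md §B7); AI work, weaker than expert review.
Written by res-L1-type-o6 (L support seat, own object 2026-08-27T10:53:20Z, counted 0; GO res-D-pv-035 AS res-L1-k24 10:54:41Z,
res-type-059 10:58:09Z with an independent check of the potential). Host: route MarkedTransfer, item `HypersurfaceOrderReduction`
(stmt-ResolutionOfSingularities-16155), `--as helper`.

## What is proved
For a "blocked" bit-set `κ : ℕ` let `freeCount κ X := #{e ≤ X : e AND κ = 0}` (the number of exponents `≤ X` bit-disjoint from `κ`;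
defined by recursion on `X`). Then
* `freeCount_zero_left`, `freeCount_pos`, `freeCount_mono`, `freeCount_succ_le`; halving rules `freeCount_odd_*` / `freeCount_even_*`;
* **sub-additivity** `freeCount_add_succ_le : y AND κ = 0 → freeCount κ (x + y) + 1 ≤ freeCount κ x + freeCount κ y`;
* **the step inequality** `freeCount_step_lt : e₀ AND κ = 0 → d AND κ = 0 → 1 ≤ e₀ → e₀ ≤ d → d ≤ δ →
  freeCount (κ + e₀) (δ + d - e₀) < freeCount κ δ`.
The companion file shows that along the universal run of a polynomial over a field of characteristic `2` the pair
(`κ` = bottom exponent, `δ` = width of the support) moves exactly by such a step, so `freeCount κ δ` is a strictly decreasing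
potential and the run dies. Hypotheses: each theorem's own binders. Standard axioms only.
-/

set_option linter.dupNamespace false -- mandated namespace of this single-conjunct summit

namespace Summit.ResolutionOfSingularities.ResolutionOfSingularities.Theorems

namespace CampaignW24

namespace ReducedRun

/-! ## Bit-disjointness through the lowest digit -/

/-- Halving an `AND`: the lowest digit multiplies, the rest shifts. [folklore] -/
theorem land_eq_zero_iff_half (a b : ℕ) : a &&& b = 0 ↔ a % 2 * (b % 2) = 0 ∧ a / 2 &&& b / 2 = 0 := by
  have hmod : (a &&& b) % 2 = a % 2 * (b % 2) := by
    have h := Nat.and_mod_two_pow (a := a) (b := b) (n := 1)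
    rw [pow_one] at h
    rw [h]
    rcases Nat.mod_two_eq_zero_or_one a with ha | ha <;> rcases Nat.mod_two_eq_zero_or_one b with hb | hb <;>
      simp [ha, hb]
  have hdiv : (a &&& b) / 2 = a / 2 &&& b / 2 := by
    simpa using (Nat.and_div_two_pow (a := a) (b := b) (n := 1))
  constructor
  · intro h
    refine ⟨?_, ?_⟩
    · rw [← hmod, h]
    · rw [← hdiv, h]
  · rintro ⟨h1, h2⟩
    have := Nat.div_add_mod (a &&& b) 2
    rw [hdiv, hmod, h1, h2] at this
    omega

/-- Disjointness from an odd number forces evenness. [folklore] -/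
theorem mod_two_eq_zero_of_land_odd {a b : ℕ} (h : a &&& b = 0) (hb : b % 2 = 1) : a % 2 = 0 := by
  have h1 := ((land_eq_zero_iff_half a b).1 h).1
  rw [hb, mul_one] at h1
  exact h1

/-- Disjointness passes to the halves. [folklore] -/
theorem land_div_two_eq_zero {a b : ℕ} (h : a &&& b = 0) : a / 2 &&& b / 2 = 0 :=
  ((land_eq_zero_iff_half a b).1 h).2

/-- Disjoint numbers add without carries in the lowest digit: `(a + b) / 2 = a / 2 + b / 2` and
`(a + b) % 2 = a % 2 + b % 2`. [folklore] -/
theorem add_div_two_of_land {a b : ℕ} (h : a &&& b = 0) :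
    (a + b) / 2 = a / 2 + b / 2 ∧ (a + b) % 2 = a % 2 + b % 2 := by
  have h1 := ((land_eq_zero_iff_half a b).1 h).1
  rcases Nat.mod_two_eq_zero_or_one a with ha | ha <;> rcases Nat.mod_two_eq_zero_or_one b with hb | hb <;>
    simp only [ha, hb, mul_one, one_ne_zero] at h1 ⊢ <;> omega

/-! ## The counting function -/

/-- [OURS · L W2.4 reduced model] `freeCount κ X` = the number of exponents `e ≤ X` with `e AND κ = 0` (bit-disjoint from `κ`),
by recursion on `X`. OURS bookkeeping; not a statement of the manuscript. [folklore] -/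
def freeCount (κ : ℕ) : ℕ → ℕ
  | 0 => 1
  | X + 1 => freeCount κ X + if (X + 1) &&& κ = 0 then 1 else 0

/-- `freeCount κ 0 = 1` (the exponent `0`). [folklore] -/
@[simp] theorem freeCount_zero (κ : ℕ) : freeCount κ 0 = 1 := rfl
/-- The recursion step. [folklore] -/
theorem freeCount_succ (κ X : ℕ) : freeCount κ (X + 1) = freeCount κ X + if (X + 1) &&& κ = 0 then 1 else 0 := rfl
/-- Step at a free exponent. [folklore] -/
theorem freeCount_succ_of_free {κ X : ℕ} (h : (X + 1) &&& κ = 0) : freeCount κ (X + 1) = freeCount κ X + 1 := by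
  rw [freeCount_succ, if_pos h]

/-- Step at a blocked exponent. [folklore] -/
theorem freeCount_succ_of_not_free {κ X : ℕ} (h : (X + 1) &&& κ ≠ 0) : freeCount κ (X + 1) = freeCount κ X := by
  rw [freeCount_succ, if_neg h, add_zero]

/-- `freeCount κ (X+1) ≤ freeCount κ X + 1`. [folklore] -/
theorem freeCount_succ_le (κ X : ℕ) : freeCount κ (X + 1) ≤ freeCount κ X + 1 := by
  rw [freeCount_succ]; split_ifs <;> omega

/-- `freeCount κ X ≤ freeCount κ (X+1)`. [folklore] -/
theorem freeCount_le_succ (κ X : ℕ) : freeCount κ X ≤ freeCount κ (X + 1) := by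
  rw [freeCount_succ]; omega
/-- Monotonicity in `X`. [folklore] -/
theorem freeCount_mono (κ : ℕ) {X Y : ℕ} (h : X ≤ Y) : freeCount κ X ≤ freeCount κ Y := by
  obtain ⟨n, rfl⟩ := Nat.exists_eq_add_of_le h
  induction n with
  | zero => exact le_rfl
  | succ n ih => exact (ih (Nat.le_add_right X n)).trans (freeCount_le_succ κ (X + n))

/-- Positivity. [folklore] -/
theorem freeCount_pos (κ X : ℕ) : 0 < freeCount κ X :=
  lt_of_lt_of_le Nat.one_pos ((freeCount_zero κ).symm.le.trans (freeCount_mono κ (Nat.zero_le X)))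

/-- With nothing blocked every exponent counts: `freeCount 0 X = X + 1`. [folklore] -/
theorem freeCount_zero_left (X : ℕ) : freeCount 0 X = X + 1 := by
  induction X with
  | zero => rfl
  | succ X ih => rw [freeCount_succ_of_free (Nat.and_zero _), ih]

/-! ## Halving rules -/

/-- `κ` odd: only even exponents are free, and `2Y`, `2Y+1` both count the free exponents `≤ Y` for `κ / 2`. [folklore] -/
theorem freeCount_odd {κ : ℕ} (hκ : κ % 2 = 1) :
    ∀ Y : ℕ, freeCount κ (2 * Y) = freeCount (κ / 2) Y ∧ freeCount κ (2 * Y + 1) = freeCount (κ / 2) Y := by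
  intro Y
  induction Y with
  | zero =>
    refine ⟨by simp, ?_⟩
    have h1 : (0 + 1) &&& κ ≠ 0 := by
      intro h
      have := mod_two_eq_zero_of_land_odd h hκ
      omega
    rw [Nat.mul_zero, freeCount_succ_of_not_free h1, freeCount_zero, freeCount_zero]
  | succ Y ih =>
    have hA : freeCount κ (2 * (Y + 1)) = freeCount (κ / 2) (Y + 1) := by
      rw [show 2 * (Y + 1) = 2 * Y + 1 + 1 by ring, freeCount_succ, ih.2, freeCount_succ]
      have hiff : (2 * Y + 1 + 1) &&& κ = 0 ↔ (Y + 1) &&& (κ / 2) = 0 := by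
        rw [land_eq_zero_iff_half]
        have e1 : (2 * Y + 1 + 1) % 2 = 0 := by omega
        have e2 : (2 * Y + 1 + 1) / 2 = Y + 1 := by omega
        rw [e1, e2, zero_mul]
        simp
      by_cases h : (Y + 1) &&& (κ / 2) = 0
      · rw [if_pos h, if_pos (hiff.2 h)]
      · rw [if_neg h, if_neg (fun h' => h (hiff.1 h'))]
    refine ⟨hA, ?_⟩
    have h1 : (2 * (Y + 1) + 1) &&& κ ≠ 0 := by
      intro h
      have := mod_two_eq_zero_of_land_odd h hκ
      omega
    rw [freeCount_succ_of_not_free h1, hA]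

/-- `κ` even, odd argument: `freeCount κ (2Y+1) = 2 · freeCount (κ/2) Y` (evens `2e ≤ 2Y+1` and odds `2e+1 ≤ 2Y+1`, `e ≤ Y`).
[folklore] -/
theorem freeCount_even_bit1 {κ : ℕ} (hκ : κ % 2 = 0) :
    ∀ Y : ℕ, freeCount κ (2 * Y + 1) = freeCount (κ / 2) Y + freeCount (κ / 2) Y ∧
      freeCount κ (2 * Y) = freeCount (κ / 2) Y + (if Y = 0 then 0 else freeCount (κ / 2) (Y - 1)) := by
  have key : ∀ X : ℕ, (X &&& κ = 0 ↔ (X / 2) &&& (κ / 2) = 0) := by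
    intro X
    rw [land_eq_zero_iff_half, hκ, mul_zero]
    simp
  intro Y
  induction Y with
  | zero =>
    refine ⟨?_, by simp⟩
    rw [Nat.mul_zero, freeCount_succ, freeCount_zero, freeCount_zero]
    have : (0 + 1) &&& κ = 0 := (key 1).2 (by simp)
    rw [if_pos this]
  | succ Y ih =>
    have hB : freeCount κ (2 * (Y + 1)) = freeCount (κ / 2) (Y + 1) + freeCount (κ / 2) Y := by
      rw [show 2 * (Y + 1) = 2 * Y + 1 + 1 by ring, freeCount_succ, ih.1, freeCount_succ (κ / 2) Y]
      have e2 : (2 * Y + 1 + 1) / 2 = Y + 1 := by omega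
      have hiff : (2 * Y + 1 + 1) &&& κ = 0 ↔ (Y + 1) &&& (κ / 2) = 0 := by rw [key, e2]
      by_cases h : (Y + 1) &&& (κ / 2) = 0
      · rw [if_pos h, if_pos (hiff.2 h)]; ring
      · rw [if_neg h, if_neg (fun h' => h (hiff.1 h'))]; ring
    refine ⟨?_, ?_⟩
    · rw [freeCount_succ, hB, freeCount_succ (κ / 2) Y]
      have e2 : (2 * (Y + 1) + 1) / 2 = Y + 1 := by omega
      have hiff : (2 * (Y + 1) + 1) &&& κ = 0 ↔ (Y + 1) &&& (κ / 2) = 0 := by rw [key, e2]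
      by_cases h : (Y + 1) &&& (κ / 2) = 0
      · rw [if_pos h, if_pos (hiff.2 h)]; ring
      · rw [if_neg h, if_neg (fun h' => h (hiff.1 h'))]; ring
    · rw [hB, if_neg (Nat.succ_ne_zero Y), Nat.add_sub_cancel]

/-- `κ` odd, any argument: `freeCount κ X = freeCount (κ/2) (X/2)`. [folklore] -/
theorem freeCount_odd_div {κ : ℕ} (hκ : κ % 2 = 1) (X : ℕ) : freeCount κ X = freeCount (κ / 2) (X / 2) := by
  obtain ⟨Y, rfl | rfl⟩ := Nat.even_or_odd' X
  · rw [(freeCount_odd hκ Y).1, Nat.mul_div_cancel_left Y two_pos]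
  · rw [(freeCount_odd hκ Y).2, show (2 * Y + 1) / 2 = Y by omega]

/-- `κ` even, odd argument. [folklore] -/
theorem freeCount_even_odd_arg {κ : ℕ} (hκ : κ % 2 = 0) (Y : ℕ) :
    freeCount κ (2 * Y + 1) = freeCount (κ / 2) Y + freeCount (κ / 2) Y := (freeCount_even_bit1 hκ Y).1

/-- `κ` even, positive even argument. [folklore] -/
theorem freeCount_even_even_arg {κ : ℕ} (hκ : κ % 2 = 0) (Y : ℕ) :
    freeCount κ (2 * (Y + 1)) = freeCount (κ / 2) (Y + 1) + freeCount (κ / 2) Y := by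
  rw [(freeCount_even_bit1 hκ (Y + 1)).2, if_neg (Nat.succ_ne_zero Y), Nat.add_sub_cancel]

/-! ## Sub-additivity at a free shift -/

/-- **Sub-additivity**: for `y` bit-disjoint from `κ`, `freeCount κ (x + y) + 1 ≤ freeCount κ x + freeCount κ y` — a window of
free exponents starting at `x` never beats the initial window. [folklore] -/
theorem freeCount_add_succ_le (κ : ℕ) :
    ∀ x y : ℕ, y &&& κ = 0 → freeCount κ (x + y) + 1 ≤ freeCount κ x + freeCount κ y := by
  induction κ using Nat.strong_induction_on with
  | _ κ ih =>
  intro x y hy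
  rcases Nat.eq_zero_or_pos x with rfl | hxpos
  · rw [Nat.zero_add, freeCount_zero]; omega
  rcases Nat.eq_zero_or_pos y with rfl | hypos
  · simp
  rcases Nat.eq_zero_or_pos κ with rfl | hκpos
  · rw [freeCount_zero_left, freeCount_zero_left, freeCount_zero_left]; omega
  have hlt : κ / 2 < κ := Nat.div_lt_self hκpos one_lt_two
  have hy₁ : (y / 2) &&& (κ / 2) = 0 := land_div_two_eq_zero hy
  rcases Nat.mod_two_eq_zero_or_one κ with hev | hodd
  · -- κ even
    obtain ⟨x₁, rfl | rfl⟩ := Nat.even_or_odd' x <;> obtain ⟨y₁, rfl | rfl⟩ := Nat.even_or_odd' y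
    · -- x = 2x₁, y = 2y₁
      have hx₁ : x₁ ≠ 0 := by omega
      have hy₁' : y₁ ≠ 0 := by omega
      obtain ⟨x₂, rfl⟩ := Nat.exists_eq_succ_of_ne_zero hx₁
      obtain ⟨y₂, rfl⟩ := Nat.exists_eq_succ_of_ne_zero hy₁'
      rw [Nat.mul_div_cancel_left _ two_pos] at hy₁
      have e : 2 * (x₂ + 1) + 2 * (y₂ + 1) = 2 * (x₂ + y₂ + 1 + 1) := by ring
      rw [e, freeCount_even_even_arg hev, freeCount_even_even_arg hev, freeCount_even_even_arg hev]
      have i1 := ih _ hlt (x₂ + 1) (y₂ + 1) hy₁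
      have i2 := ih _ hlt x₂ (y₂ + 1) hy₁
      have e1 : x₂ + 1 + (y₂ + 1) = x₂ + y₂ + 1 + 1 := by ring
      have e2 : x₂ + (y₂ + 1) = x₂ + y₂ + 1 := by ring
      rw [e1] at i1; rw [e2] at i2
      have hfy := freeCount_succ_of_free (κ := κ / 2) (X := y₂) hy₁
      omega
    · -- x = 2x₁, y = 2y₁+1
      have hx₁ : x₁ ≠ 0 := by omega
      obtain ⟨x₂, rfl⟩ := Nat.exists_eq_succ_of_ne_zero hx₁
      rw [show (2 * y₁ + 1) / 2 = y₁ by omega] at hy₁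
      have e : 2 * (x₂ + 1) + (2 * y₁ + 1) = 2 * (x₂ + 1 + y₁) + 1 := by ring
      rw [e, freeCount_even_odd_arg hev, freeCount_even_even_arg hev, freeCount_even_odd_arg hev]
      have i1 := ih _ hlt (x₂ + 1) y₁ hy₁
      have i2 := ih _ hlt x₂ y₁ hy₁
      have hs := freeCount_succ_le (κ / 2) (x₂ + y₁)
      have e1 : x₂ + 1 + y₁ = x₂ + y₁ + 1 := by ring
      rw [e1] at i1 ⊢
      omega
    · -- x = 2x₁+1, y = 2y₁
      have hy₁' : y₁ ≠ 0 := by omega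
      obtain ⟨y₂, rfl⟩ := Nat.exists_eq_succ_of_ne_zero hy₁'
      rw [Nat.mul_div_cancel_left _ two_pos] at hy₁
      have e : 2 * x₁ + 1 + 2 * (y₂ + 1) = 2 * (x₁ + y₂ + 1) + 1 := by ring
      rw [e, freeCount_even_odd_arg hev, freeCount_even_odd_arg hev, freeCount_even_even_arg hev]
      have i1 := ih _ hlt x₁ (y₂ + 1) hy₁
      have e1 : x₁ + (y₂ + 1) = x₁ + y₂ + 1 := by ring
      rw [e1] at i1
      have hfy := freeCount_succ_of_free (κ := κ / 2) (X := y₂) hy₁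
      omega
    · -- x = 2x₁+1, y = 2y₁+1
      rw [show (2 * y₁ + 1) / 2 = y₁ by omega] at hy₁
      have e : 2 * x₁ + 1 + (2 * y₁ + 1) = 2 * (x₁ + y₁ + 1) := by ring
      rw [e, freeCount_even_even_arg hev, freeCount_even_odd_arg hev, freeCount_even_odd_arg hev]
      have i1 := ih _ hlt x₁ y₁ hy₁
      have hs := freeCount_succ_le (κ / 2) (x₁ + y₁)
      omega
  · -- κ odd: y is even
    have hy0 : y % 2 = 0 := mod_two_eq_zero_of_land_odd hy hodd
    obtain ⟨y₁, rfl⟩ : ∃ y₁, y = 2 * y₁ := ⟨y / 2, by omega⟩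
    rw [Nat.mul_div_cancel_left _ two_pos] at hy₁
    rw [freeCount_odd_div hodd, freeCount_odd_div hodd x, freeCount_odd_div hodd (2 * y₁),
      Nat.mul_div_cancel_left _ two_pos]
    have i1 := ih _ hlt (x / 2) y₁ hy₁
    have e : (x + 2 * y₁) / 2 = x / 2 + y₁ := by omega
    rw [e]
    exact i1

/-! ## The step inequality (the potential strictly decreases) -/

/-- **The step inequality.** If `e₀` and `d` are bit-disjoint from `κ` and `1 ≤ e₀ ≤ d ≤ δ`, then
`freeCount (κ + e₀) (δ + d - e₀) < freeCount κ δ`: blocking the bits of `e₀` at least halves the density of free exponents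
while the window less than doubles. [folklore] -/
theorem freeCount_step_lt :
    ∀ δ κ e₀ d : ℕ, e₀ &&& κ = 0 → d &&& κ = 0 → 1 ≤ e₀ → e₀ ≤ d → d ≤ δ →
      freeCount (κ + e₀) (δ + d - e₀) < freeCount κ δ := by
  intro δ
  induction δ using Nat.strong_induction_on with
  | _ δ ih =>
  intro κ e₀ d he hd h1 h2 h3
  have hδpos : 0 < δ := by omega
  have he₁ : (e₀ / 2) &&& (κ / 2) = 0 := land_div_two_eq_zero he
  have hd₁ : (d / 2) &&& (κ / 2) = 0 := land_div_two_eq_zero hd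
  have hsum := add_div_two_of_land he
  have hltδ : δ / 2 < δ := Nat.div_lt_self hδpos one_lt_two
  have hεk := ((land_eq_zero_iff_half e₀ κ).1 he).1
  have hηk := ((land_eq_zero_iff_half d κ).1 hd).1
  have hhalf : (κ + e₀) / 2 = κ / 2 + e₀ / 2 := by rw [add_comm, hsum.1, add_comm]
  have hparsum : (κ + e₀) % 2 = κ % 2 + e₀ % 2 := by rw [add_comm, hsum.2, add_comm]
  rcases Nat.mod_two_eq_zero_or_one κ with hk0 | hk1
  · -- κ even
    have hεfree : e₀ % 2 = 0 ∨ e₀ % 2 = 1 := Nat.mod_two_eq_zero_or_one e₀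
    obtain ⟨δ₁, rfl | rfl⟩ := Nat.even_or_odd' δ
    · -- δ = 2δ₁ with δ₁ ≥ 1 : RHS = f δ₁ + f (δ₁ - 1)
      have hδ₁ : δ₁ ≠ 0 := by omega
      obtain ⟨δ₂, rfl⟩ : ∃ δ₂, δ₁ = δ₂ + 1 := ⟨δ₁ - 1, by omega⟩
      rw [freeCount_even_even_arg hk0]
      have hlt' : δ₂ + 1 < 2 * (δ₂ + 1) := by omega
      have hsδ := freeCount_succ_le (κ / 2) δ₂
      rcases hεfree with hε0 | hε1
      · -- e₀ even (so e₀ ≥ 2)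
        have hpar : (κ + e₀) % 2 = 0 := by omega
        have he1pos : 1 ≤ e₀ / 2 := by omega
        have iZ := ih (δ₂ + 1) hlt' (κ / 2) (e₀ / 2) (d / 2) he₁ hd₁ he1pos (by omega) (by omega)
        rcases Nat.mod_two_eq_zero_or_one d with hη0 | hη1
        · -- d even: X = 2 Z with Z = δ₂ + 1 + d/2 - e₀/2
          rcases Nat.eq_zero_or_pos (δ₂ + 1 + d / 2 - e₀ / 2) with hZ0 | hZpos
          · have eX : 2 * (δ₂ + 1) + d - e₀ = 0 := by omega
            rw [eX, freeCount_zero]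
            have := freeCount_pos (κ / 2) (δ₂ + 1)
            have := freeCount_pos (κ / 2) δ₂
            omega
          · obtain ⟨W, hW⟩ : ∃ W, δ₂ + 1 + d / 2 - e₀ / 2 = W + 1 := ⟨δ₂ + 1 + d / 2 - e₀ / 2 - 1, by omega⟩
            have eX : 2 * (δ₂ + 1) + d - e₀ = 2 * (W + 1) := by omega
            rw [eX, freeCount_even_even_arg hpar, hhalf]
            have hWZ : W + 1 = δ₂ + 1 + d / 2 - e₀ / 2 := by omega
            have hm := freeCount_le_succ (κ / 2 + e₀ / 2) W
            rw [hWZ] at hm ⊢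
            omega
        · -- d odd: X = 2 Z + 1, and d/2 ≤ δ₂
          have eX : 2 * (δ₂ + 1) + d - e₀ = 2 * (δ₂ + 1 + d / 2 - e₀ / 2) + 1 := by omega
          rw [eX, freeCount_even_odd_arg hpar, hhalf]
          omega
      · -- e₀ odd: κ + e₀ odd
        have hpar : (κ + e₀) % 2 = 1 := by omega
        rw [freeCount_odd_div hpar, hhalf]
        rcases Nat.eq_zero_or_pos (e₀ / 2) with he1z | he1pos
        · -- e₀ = 1
          rw [he1z, Nat.add_zero]
          have sa := freeCount_add_succ_le (κ / 2) (δ₂ + 1) (d / 2) hd₁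
          have sa' := freeCount_add_succ_le (κ / 2) δ₂ (d / 2) hd₁
          have hmono : freeCount (κ / 2) (d / 2) ≤ freeCount (κ / 2) (δ₂ + 1) := freeCount_mono _ (by omega)
          rcases Nat.mod_two_eq_zero_or_one d with hη0 | hη1
          · have eX : (2 * (δ₂ + 1) + d - e₀) / 2 = δ₂ + d / 2 := by omega
            rw [eX]
            omega
          · have hmono' : freeCount (κ / 2) (d / 2) ≤ freeCount (κ / 2) δ₂ := freeCount_mono _ (by omega)
            have eX : (2 * (δ₂ + 1) + d - e₀) / 2 = δ₂ + 1 + d / 2 := by omega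
            rw [eX]
            omega
        · have iZ := ih (δ₂ + 1) hlt' (κ / 2) (e₀ / 2) (d / 2) he₁ hd₁ he1pos (by omega) (by omega)
          have hmono : freeCount (κ / 2 + e₀ / 2) ((2 * (δ₂ + 1) + d - e₀) / 2) ≤
              freeCount (κ / 2 + e₀ / 2) (δ₂ + 1 + d / 2 - e₀ / 2) := freeCount_mono _ (by omega)
          omega
    · -- δ = 2δ₁ + 1 : RHS = f δ₁ + f δ₁
      rw [freeCount_even_odd_arg hk0]
      have hlt' : δ₁ < 2 * δ₁ + 1 := by omega
      rcases hεfree with hε0 | hε1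
      · have hpar : (κ + e₀) % 2 = 0 := by omega
        have he1pos : 1 ≤ e₀ / 2 := by omega
        have iZ := ih δ₁ hlt' (κ / 2) (e₀ / 2) (d / 2) he₁ hd₁ he1pos (by omega) (by omega)
        rcases Nat.mod_two_eq_zero_or_one d with hη0 | hη1
        · have eX : 2 * δ₁ + 1 + d - e₀ = 2 * (δ₁ + d / 2 - e₀ / 2) + 1 := by omega
          rw [eX, freeCount_even_odd_arg hpar, hhalf]
          omega
        · have eX : 2 * δ₁ + 1 + d - e₀ = 2 * (δ₁ + d / 2 - e₀ / 2 + 1) := by omega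
          rw [eX, freeCount_even_even_arg hpar, hhalf]
          have hs := freeCount_succ_le (κ / 2 + e₀ / 2) (δ₁ + d / 2 - e₀ / 2)
          omega
      · have hpar : (κ + e₀) % 2 = 1 := by omega
        rw [freeCount_odd_div hpar, hhalf]
        rcases Nat.eq_zero_or_pos (e₀ / 2) with he1z | he1pos
        · rw [he1z, Nat.add_zero]
          have sa := freeCount_add_succ_le (κ / 2) δ₁ (d / 2) hd₁
          have hmono : freeCount (κ / 2) (d / 2) ≤ freeCount (κ / 2) δ₁ := freeCount_mono _ (by omega)
          have eX : (2 * δ₁ + 1 + d - e₀) / 2 = δ₁ + d / 2 := by omega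
          rw [eX]
          omega
        · have iZ := ih δ₁ hlt' (κ / 2) (e₀ / 2) (d / 2) he₁ hd₁ he1pos (by omega) (by omega)
          have hmono : freeCount (κ / 2 + e₀ / 2) ((2 * δ₁ + 1 + d - e₀) / 2) ≤
              freeCount (κ / 2 + e₀ / 2) (δ₁ + d / 2 - e₀ / 2) := freeCount_mono _ (by omega)
          have hpos := freeCount_pos (κ / 2) δ₁
          omega
  · -- κ odd: e₀, d even; everything halves
    have hε0 : e₀ % 2 = 0 := mod_two_eq_zero_of_land_odd he hk1
    have hη0 : d % 2 = 0 := mod_two_eq_zero_of_land_odd hd hk1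
    have hpar : (κ + e₀) % 2 = 1 := by omega
    rw [freeCount_odd_div hpar, hhalf, freeCount_odd_div hk1 δ]
    have he1pos : 1 ≤ e₀ / 2 := by omega
    have iZ := ih (δ / 2) hltδ (κ / 2) (e₀ / 2) (d / 2) he₁ hd₁ he1pos (by omega) (by omega)
    have eX : (δ + d - e₀) / 2 = δ / 2 + d / 2 - e₀ / 2 := by omega
    rw [eX]
    exact iZ

end ReducedRun

end CampaignW24

end Summit.ResolutionOfSingularities.ResolutionOfSingularities.Theorems
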